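import Literature.NumberTheory.EllipticCurves.PAdicTwoVariableColemanImageCocycleOfUnitsGaloisAux
import Literature.NumberTheory.EllipticCurves.PAdicTwoVariableColemanImageCocycleOfUnitsTrace
import Literature.NumberTheory.GaloisRepresentations.LocalFieldDyadicCharacterKernel
import HarnessLib

/-!
# The auxiliary index `a₂` of de Shalit II §4.12 at `p = 2` for a GENERAL Lubin–Tate character value: the evaluated twist character
# `v ↦ (t_v)(b)` is a homomorphism `𝒪_F^× → 𝒪_F^×` with `γ ↦ n_{a₁}`, so its kernel is `⊆ {±1}` — and **`ha₂` holds whenever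
# `n_{a₂} = n_{a₁}^k` but `χ_π(σ̃_{a₂}) ≠ ±γ^k`** (e.g. `𝔞₂ = 𝔞̄₁`, the conjugate ideal)

De Shalit, *Iwasawa theory of elliptic curves with complex multiplication* (1987), II §4.12 (29)–(33): the division of the cocycle
`𝔞 ↦ i(e(𝔞))` by `σ_{𝔞₁} − N𝔞₁` needs ONE auxiliary `𝔞₂` with `(σ_{𝔞₁} − N𝔞₁, σ_{𝔞₂} − N𝔞₂)` relatively prime.  In the tree
(`PAdicTwoVariableColemanImageCocycleOfUnitsGalois` S23, `…Trace` S43, the (c)-capstones `Summit…ColemanCoinvariantChar*`) this is the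
hypothesis **`ha₂ : maxEval_b (t_{χ(σ̃_{a₂})} − C(n_{a₂} g_{a₂}⁻¹)) ≠ 0`**, `b = n_{a₁} g_{a₁}⁻¹ − 1`, `t_v = φ_ε(σ_v 1)` the twist
scalar.  `…GaloisAux` (S27) discharged it when `χ_π(σ̃_{a₂}) = γ^k` and `n_{a₁}^k ≠ n_{a₂}` — a criterion that is NEVER met by the
local lifts of the Artin symbols of a field of class number one (`χ_π(σ̃_{(a)}) = a`, `RayClassFieldLocalTowerCharacter`: `χ = γ^k`
forces `(a) = 𝔞₁^k`, `n_{a₂} = n_{a₁}^k`).  THIS file proves the complementary and GENERAL criterion (everything PROVED, 0 sorry, no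
definitions, no named facts):

* §1 (any base `S`, any ring map `Ψ : Λ = S⟦T⟧ → 𝒪_F`) the evaluated twist character `v ↦ Ψ(t_v)` is multiplicative with `1 ↦ 1`,
  `γ ↦ 1 + Ψ(T)` (`eval_twistScalar_one/mul/self`); ★★ `units_eq_or_eq_neg_of_eval_twistScalar_eq` — if `π² ∣ Ψ(T) ≠ 0` then
  **`Ψ(t_v) = Ψ(t_{v'}) ⟹ v = ±v'`** (the KERNEL THEOREM of `LocalFieldDyadicCharacterKernel`: no continuity of `v ↦ t_v` is needed —
  `U_{N+3} ⊆ (𝒪_F^×)^{2^{N+1}}` and `Ψ(t_x)^{2^{N+1}} ∈ U_{N+3}` force it).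
* §2 (`S = 𝒪_F⟦X⟧`, `Ψ = (X ↦ 0) ∘ maxEval_b`, `b = n₁ g₁⁻¹ − 1`, `g_i(0) = 1`): `constantCoeff_maxEval_twistScalar_self`
  (`γ ↦ n₁`), ★★★ **`maxEval_twistFactor_ne_zero_of_ne_of_ne_neg`** — `π² ∣ n₁ − 1`, `n₁ ≠ 1`, `n₂ = n₁^k`, `v₂ ≠ γ^k`,
  `v₂ ≠ −γ^k ⟹ maxEval_b (t_{v₂} − C(n₂ g₂⁻¹)) ≠ 0`; the case `k = 1` (`n₂ = n₁`, `v₂ ≠ ±γ`: the CONJUGATE IDEAL `𝔞₂ = 𝔞̄₁` of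
  de Shalit's `𝔞₁ = (α₁)`, `χ_π(σ̃_{𝔞̄₁}) = ᾱ₁ ≠ ±α₁`) is `maxEval_twistFactor_ne_zero_of_ne_of_ne_neg_self`; and the comparison
  with a POWER character (§1 `units_eq_one_or_eq_neg_one_of_eval_twistScalar_eq_pow`): ★★★ **`maxEval_twistFactor_ne_zero_of_natCast_eq_pow`**
  — `n₂ = v₂^m` in `𝒪_F`, `n₁ ≠ γ^m`, `v₂ ≠ ±1 ⟹ ha₂` (a RATIONAL index `𝔞₂ = (r)`, `r ∈ ℕ ∖ {1}`, `r ≡ 1 mod 𝔤v̄^{ν+1}`: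
  `χ_π(σ̃_{(r)}) = r`, `N(r) = r²`, `m = 2`, and `n₁ = α₁ᾱ₁ ≠ α₁²` iff `ᾱ₁ ≠ α₁`).
* §3 ★★ `existsUnique_colemanDeltaCoinvFun_colemanImageCoh_trace_eq_twistMul_of_ne` — S43's `∃! L_ε` on the `ℤ/d`-trace (every `d`)
  with `a₂` specified by `n_{a₂} = n_{a₁}^k`, `χ_π(σ̃_{a₂}) ≠ ±γ^k`; ★★ `…_of_natCast_eq_pow` — the same with `a₂` from a power character
  (`n_{a₂} = χ_π(σ̃_{a₂})^m`, `χ ≠ ±1`, `n_{a₁} ≠ γ^m`: rational index).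

WHY `π² ∣ n₁ − 1`: the kernel theorem wants the value at `γ` in `U_2` (at `p = 2` the level-one units `≡ 3 (mod 4)` square into
`U_3` and the exact-level bookkeeping starts at level `2`); for de Shalit's `𝔞₁ = (α₁)`, `α₁ ≡ 1 mod 𝔤v̄v²`, one has
`n₁ = α₁ᾱ₁ ≡ 1 (mod v²)` as soon as `α₁ ≡ 1 (mod v̄²)` as well.

Cell `bsd-print-cf2`, width seat `bsd-line-cf2c-w7` g18 (finding F3 of g16 / (A2) of g17).

## References
* E. de Shalit, *Iwasawa theory of elliptic curves with complex multiplication* (1987), Ch. I §3.1; Ch. II §4.12 (29)–(33), §4.14. [deShalit1987]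
* J.-P. Serre, *A Course in Arithmetic* (1973), Ch. II §3.2 Thm. 3, §3.3. [Serre1973CourseArithmetic]
* L. C. Washington, *Introduction to Cyclotomic Fields*, 2nd ed. (1997), §7.1 Prop. 7.2. [Washington1997]
-/

noncomputable section

namespace Literature.NumberTheory.EllipticCurves

open ValuativeRel IsLocalRing Field
open Literature.NumberTheory.GaloisRepresentations Literature.NumberTheory.GaloisRepresentations.IsNonarchimedeanLocalField
  Literature.NumberTheory.GaloisRepresentations.LubinTate
open Literature.RingTheory.PowerSeries (maxEval maxEvalHom maxEvalHom_apply maxEval_C maxEval_X)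

variable {F : Type} [Field F] [ValuativeRel F] [TopologicalSpace F] [IsNonarchimedeanLocalField F]

attribute [local instance] ltNormUniformSpace ltNormIsUniformAddGroup rk1 nF nE fintypeResidueField
attribute [local instance] RelNormCoherentUnits.instCommMonoid
attribute [local instance] isAdicComplete_maximalIdeal_powerSeries_integer

/-! ### §1. The evaluated twist character `v ↦ Ψ(t_v)` and its kernel -/

section Eval

variable {π : 𝒪[F]} (hπ : (valuation F).IsUniformizer (π : F)) (hq : residueFieldCard F = 2)
variable {S : Type*} [CommRing S] (ι : LTCoeff F →+* S) [IsAdicComplete (Ideal.span {ι (LTCoeff.of F π)}) S]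
variable (u : (LTCoeff F)ˣ) (hu : LTCoeff.of F π = residueFieldCard F * u) (γ : 𝒪[F]ˣ)
variable (hreg : ∀ s : S, ι (LTCoeff.of F π) * s = 0 → s = 0) (w : 𝒪[F]ˣ) (hγ : (γ : 𝒪[F]) = 1 + π ^ 2 * w)
variable (ε : PowerSeries S) (hε : ε * ε = 1) (Ψ : PowerSeries S →+* 𝒪[F])

include hq hu in
/-- At `q = 2` with `π = 2u`: `2 = π·u⁻¹` in `𝒪_F`, `u⁻¹` a unit. [cite: deShalit1987, Ch. I §3.1] -/
theorem two_eq_uniformizer_mul_units_inv :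
    (2 : 𝒪[F]) = π * ((Units.map (LTCoeff.of F).symm.toRingHom.toMonoidHom u⁻¹ : 𝒪[F]ˣ) : 𝒪[F]) := by
  have h := congrArg (LTCoeff.of F).symm (two_eq_of_mul_inv (π := π) hq u hu)
  rw [map_ofNat, map_mul, RingEquiv.symm_apply_apply] at h
  exact h

/-- `Ψ(t_1) = 1`. [cite: deShalit1987, Ch. I §3.1] -/
theorem eval_twistScalar_one :
    Ψ (colemanDeltaCoinvFun hπ hq ι u hu γ hreg w hγ ε (unitTwistₗ hπ hq ι u hu γ 1 (TActModule.ofPS _ _ 1))) = 1 := by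
  rw [colemanDeltaCoinvFun_unitTwistₗ_one_one, map_one]

include hε in
/-- `Ψ(t_{vv'}) = Ψ(t_v)·Ψ(t_{v'})`: the evaluated twist character is multiplicative. [cite: deShalit1987, Ch. I §3.1] -/
theorem eval_twistScalar_mul (v v' : 𝒪[F]ˣ) :
    Ψ (colemanDeltaCoinvFun hπ hq ι u hu γ hreg w hγ ε (unitTwistₗ hπ hq ι u hu γ (v * v') (TActModule.ofPS _ _ 1))) =
      Ψ (colemanDeltaCoinvFun hπ hq ι u hu γ hreg w hγ ε (unitTwistₗ hπ hq ι u hu γ v (TActModule.ofPS _ _ 1))) *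
        Ψ (colemanDeltaCoinvFun hπ hq ι u hu γ hreg w hγ ε (unitTwistₗ hπ hq ι u hu γ v' (TActModule.ofPS _ _ 1))) := by
  rw [colemanDeltaCoinvFun_unitTwistₗ_mul_one hπ hq ι u hu γ hreg w hγ ε hε, map_mul]

/-- `Ψ(t_γ) = 1 + Ψ(T)`. [cite: deShalit1987, Ch. I §3.1] -/
theorem eval_twistScalar_self :
    Ψ (colemanDeltaCoinvFun hπ hq ι u hu γ hreg w hγ ε (unitTwistₗ hπ hq ι u hu γ γ (TActModule.ofPS _ _ 1))) = 1 + Ψ PowerSeries.X := by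
  rw [colemanDeltaCoinvFun_unitTwistₗ_self_one, map_add, map_one]

include hε hu in
/-- ★★ **The kernel of the evaluated twist character**: if `π² ∣ Ψ(T)` and `Ψ(T) ≠ 0` (the value `1 + Ψ(T)` at `γ` lies in
`U_2 ∖ {1}`), then **`Ψ(t_v) = Ψ(t_{v'}) ⟹ v = v' ∨ v = −v'`** — by the kernel theorem for characters of the dyadic unit group
(`LocalFieldDyadicCharacterKernel`); NO continuity of `v ↦ t_v` is used. [cite: deShalit1987, Ch. I §3.1; Ch. II §4.12 (29)–(33)]
[cite: Serre1973CourseArithmetic, Ch. II §3.2 Thm. 3, §3.3] -/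
theorem units_eq_or_eq_neg_of_eval_twistScalar_eq (hΨ : π ^ 2 ∣ Ψ PowerSeries.X) (hΨ0 : Ψ PowerSeries.X ≠ 0) {v v' : 𝒪[F]ˣ}
    (h : Ψ (colemanDeltaCoinvFun hπ hq ι u hu γ hreg w hγ ε (unitTwistₗ hπ hq ι u hu γ v (TActModule.ofPS _ _ 1))) =
      Ψ (colemanDeltaCoinvFun hπ hq ι u hu γ hreg w hγ ε (unitTwistₗ hπ hq ι u hu γ v' (TActModule.ofPS _ _ 1)))) :
    v = v' ∨ v = -v' := by
  refine units_eq_or_eq_neg_of_apply_eq hπ hq (two_eq_uniformizer_mul_units_inv hq u hu)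
    (fun x : 𝒪[F]ˣ => Ψ (colemanDeltaCoinvFun hπ hq ι u hu γ hreg w hγ ε (unitTwistₗ hπ hq ι u hu γ x (TActModule.ofPS _ _ 1))))
    (eval_twistScalar_one hπ hq ι u hu γ hreg w hγ ε Ψ) (eval_twistScalar_mul hπ hq ι u hu γ hreg w hγ ε hε Ψ) hγ ?_ ?_ h
  · rw [eval_twistScalar_self, add_sub_cancel_left]; exact hΨ
  · rw [eval_twistScalar_self, Ne, add_eq_left]; exact hΨ0

include hε hu in
/-- ★★ **Comparison with a power character**: if `π² ∣ Ψ(T)` and `1 + Ψ(T) ≠ γ^m` then **`Ψ(t_v) = v^m ⟹ v = 1 ∨ v = −1`** (the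
kernel theorem applied to `v ↦ Ψ(t_v)·v^{−m}`, whose value at `γ` is `(1 + Ψ(T))γ^{−m} ∈ U_2 ∖ {1}`).
[cite: deShalit1987, Ch. I §3.1; Ch. II §4.12 (29)–(33)] [cite: Serre1973CourseArithmetic, Ch. II §3.2 Thm. 3, §3.3] -/
theorem units_eq_one_or_eq_neg_one_of_eval_twistScalar_eq_pow (hΨ : π ^ 2 ∣ Ψ PowerSeries.X) (m : ℕ)
    (hne : 1 + Ψ PowerSeries.X ≠ (γ : 𝒪[F]) ^ m) {v : 𝒪[F]ˣ}
    (h : Ψ (colemanDeltaCoinvFun hπ hq ι u hu γ hreg w hγ ε (unitTwistₗ hπ hq ι u hu γ v (TActModule.ofPS _ _ 1))) = (v : 𝒪[F]) ^ m) :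
    v = 1 ∨ v = -1 := by
  have hγ2 : π ^ 2 ∣ (γ : 𝒪[F]) - 1 := ⟨w, by rw [hγ, add_sub_cancel_left]⟩
  refine units_eq_one_or_eq_neg_one_of_apply_eq_one hπ hq (two_eq_uniformizer_mul_units_inv hq u hu)
    (fun x : 𝒪[F]ˣ => Ψ (colemanDeltaCoinvFun hπ hq ι u hu γ hreg w hγ ε (unitTwistₗ hπ hq ι u hu γ x (TActModule.ofPS _ _ 1))) *
      (((x ^ m)⁻¹ : 𝒪[F]ˣ) : 𝒪[F])) ?_ ?_ hγ ?_ ?_ ?_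
  · rw [eval_twistScalar_one, one_pow, inv_one, Units.val_one, mul_one]
  · intro v₁ v₂
    rw [eval_twistScalar_mul hπ hq ι u hu γ hreg w hγ ε hε Ψ, mul_pow, mul_inv, Units.val_mul]
    ring
  · rw [eval_twistScalar_self]
    refine pi_pow_dvd_mul_sub_one ?_ (pi_pow_dvd_units_inv_sub_one (by rw [Units.val_pow_eq_pow_val]; exact pi_pow_dvd_pow_sub_one hγ2 m))
    rw [add_sub_cancel_left]; exact hΨ
  · intro h1
    apply hne
    rw [eval_twistScalar_self] at h1
    have h2 := congrArg (fun x : 𝒪[F] => x * ((γ ^ m : 𝒪[F]ˣ) : 𝒪[F])) h1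
    simp only [mul_assoc, ← Units.val_mul, inv_mul_cancel, Units.val_one, mul_one, one_mul] at h2
    rw [h2, Units.val_pow_eq_pow_val]
  · rw [h, ← Units.val_pow_eq_pow_val, ← Units.val_mul, mul_inv_cancel, Units.val_one]

end Eval

/-! ### §2. Over `𝒪_F⟦X⟧` at the point `b = n₁ g₁⁻¹ − 1`: the auxiliary index from `n₂ = n₁^k`, `v₂ ≠ ±γ^k` -/

section Integer

variable {π : 𝒪[F]} (hπ : (valuation F).IsUniformizer (π : F))
variable [IsAdicComplete (Ideal.span {intBase F (LTCoeff.of F π)}) (PowerSeries 𝒪[F])]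
variable (hq : residueFieldCard F = 2) (u : (LTCoeff F)ˣ) (hu : LTCoeff.of F π = residueFieldCard F * u) (γ w : 𝒪[F]ˣ)
  (hγ : (γ : 𝒪[F]) = 1 + π ^ 2 * w) (ε : PowerSeries (PowerSeries 𝒪[F])) (hε : ε * ε = 1)

omit [TopologicalSpace F] [IsNonarchimedeanLocalField F] in
/-- `(g⁻¹)(0) = 1` for a unit `g` of `𝒪_F⟦X⟧` with `g(0) = 1`. [cite: deShalit1987, Ch. II §4.12 (29)] -/
theorem constantCoeff_units_inv_eq_one (g : (PowerSeries 𝒪[F])ˣ) (hg : PowerSeries.constantCoeff (g : PowerSeries 𝒪[F]) = 1) :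
    PowerSeries.constantCoeff ((g⁻¹ : (PowerSeries 𝒪[F])ˣ) : PowerSeries 𝒪[F]) = 1 := by
  have h := congrArg PowerSeries.constantCoeff g.inv_mul
  rw [map_mul, hg, mul_one, map_one] at h
  exact h

omit [TopologicalSpace F] [IsNonarchimedeanLocalField F] in
/-- `(n₁ g₁⁻¹ − 1)(0) = n₁ − 1`. [cite: deShalit1987, Ch. II §4.12 (29)] -/
theorem constantCoeff_natCast_mul_inv_sub_one (n₁ : ℕ) (g₁ : (PowerSeries 𝒪[F])ˣ)
    (hg₁ : PowerSeries.constantCoeff (g₁ : PowerSeries 𝒪[F]) = 1) :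
    PowerSeries.constantCoeff (((n₁ : ℕ) : PowerSeries 𝒪[F]) * ((g₁⁻¹ : (PowerSeries 𝒪[F])ˣ) : PowerSeries 𝒪[F]) - 1) = (n₁ : 𝒪[F]) - 1 := by
  rw [map_sub, map_mul, map_natCast, constantCoeff_units_inv_eq_one g₁ hg₁, mul_one, map_one]

include hπ hε hu in
/-- ★★★ **THE AUXILIARY INDEX FOR A GENERAL CHARACTER VALUE**: with `b = n₁ g₁⁻¹ − 1` (`g₁(0) = g₂(0) = 1`), `π² ∣ n₁ − 1`, `n₁ ≠ 1`:
if `n₂ = n₁^k` while `v₂ ≠ γ^k` and `v₂ ≠ −γ^k`, then **`maxEval_b (t_{v₂} − C(n₂ g₂⁻¹)) ≠ 0`** — its constant term `ψ_b(v₂) − n₂`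
vanishes only if `ψ_b(v₂) = ψ_b(γ^k)`, i.e. `v₂ = ±γ^k`.  Complementary to `maxEval_twistFactor_ne_zero_of_pow_ne` (`v₂ = γ^k`,
`n₂ ≠ n₁^k`). [cite: deShalit1987, Ch. II §4.12 (29)–(33)] [cite: Serre1973CourseArithmetic, Ch. II §3.2 Thm. 3] -/
theorem maxEval_twistFactor_ne_zero_of_ne_of_ne_neg [CharZero F] {n₁ n₂ k : ℕ} (g₁ g₂ : (PowerSeries 𝒪[F])ˣ)
    (hg₁ : PowerSeries.constantCoeff (g₁ : PowerSeries 𝒪[F]) = 1) (hg₂ : PowerSeries.constantCoeff (g₂ : PowerSeries 𝒪[F]) = 1)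
    (hb : ((n₁ : ℕ) : PowerSeries 𝒪[F]) * ((g₁⁻¹ : (PowerSeries 𝒪[F])ˣ) : PowerSeries 𝒪[F]) - 1 ∈ maximalIdeal (PowerSeries 𝒪[F]))
    (hn₁ : π ^ 2 ∣ (n₁ : 𝒪[F]) - 1) (hn₁' : n₁ ≠ 1) (hn₂ : n₂ = n₁ ^ k)
    {v₂ : 𝒪[F]ˣ} (hv₂ : v₂ ≠ γ ^ k) (hv₂' : v₂ ≠ -γ ^ k) :
    maxEval hb (colemanDeltaCoinvFun hπ hq (intBase F) u hu γ (eq_zero_of_C_pi_mul_eq_zero_integer hπ) w hγ ε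
        (unitTwistₗ hπ hq (intBase F) u hu γ v₂ (TActModule.ofPS _ _ 1)) -
      PowerSeries.C (((n₂ : ℕ) : PowerSeries 𝒪[F]) * ((g₂⁻¹ : (PowerSeries 𝒪[F])ˣ) : PowerSeries 𝒪[F]))) ≠ 0 := by
  intro h
  -- the evaluation `Ψ = (X ↦ 0) ∘ maxEval_b : Λ → 𝒪_F`
  set Ψ : PowerSeries (PowerSeries 𝒪[F]) →+* 𝒪[F] := (PowerSeries.constantCoeff (R := 𝒪[F])).comp (maxEvalHom hb) with hΨ
  have hΨX : Ψ PowerSeries.X = (n₁ : 𝒪[F]) - 1 := by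
    rw [hΨ, RingHom.comp_apply, maxEvalHom_apply, maxEval_X, constantCoeff_natCast_mul_inv_sub_one n₁ g₁ hg₁]
  have hΨ2 : π ^ 2 ∣ Ψ PowerSeries.X := by rw [hΨX]; exact hn₁
  have hΨ0 : Ψ PowerSeries.X ≠ 0 := by
    rw [hΨX, sub_ne_zero]
    intro h1
    apply hn₁'
    have h1' := congrArg (fun x : 𝒪[F] => (x : F)) h1
    push_cast at h1'
    exact_mod_cast h1'
  -- the constant term of the value: `Ψ(t_{v₂}) = n₂`
  have hval : Ψ (colemanDeltaCoinvFun hπ hq (intBase F) u hu γ (eq_zero_of_C_pi_mul_eq_zero_integer hπ) w hγ ε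
      (unitTwistₗ hπ hq (intBase F) u hu γ v₂ (TActModule.ofPS _ _ 1))) = (n₂ : 𝒪[F]) := by
    have h0 : Ψ (colemanDeltaCoinvFun hπ hq (intBase F) u hu γ (eq_zero_of_C_pi_mul_eq_zero_integer hπ) w hγ ε
        (unitTwistₗ hπ hq (intBase F) u hu γ v₂ (TActModule.ofPS _ _ 1)) -
        PowerSeries.C (((n₂ : ℕ) : PowerSeries 𝒪[F]) * ((g₂⁻¹ : (PowerSeries 𝒪[F])ˣ) : PowerSeries 𝒪[F]))) = 0 := by
      rw [hΨ, RingHom.comp_apply, maxEvalHom_apply, h, map_zero]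
    rw [map_sub, sub_eq_zero] at h0
    rw [h0, hΨ, RingHom.comp_apply, maxEvalHom_apply, maxEval_C, map_mul, map_natCast, constantCoeff_units_inv_eq_one g₂ hg₂, mul_one]
  -- `Ψ(t_{γ^k}) = n₁^k = n₂`
  have hpow : Ψ (colemanDeltaCoinvFun hπ hq (intBase F) u hu γ (eq_zero_of_C_pi_mul_eq_zero_integer hπ) w hγ ε
      (unitTwistₗ hπ hq (intBase F) u hu γ (γ ^ k) (TActModule.ofPS _ _ 1))) = (n₂ : 𝒪[F]) := by
    rw [colemanDeltaCoinvFun_unitTwistₗ_pow_one, map_pow, map_add, map_one, hΨX, add_sub_cancel, hn₂, Nat.cast_pow]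
  rcases units_eq_or_eq_neg_of_eval_twistScalar_eq hπ hq (intBase F) u hu γ (eq_zero_of_C_pi_mul_eq_zero_integer hπ) w hγ ε hε Ψ hΨ2 hΨ0
    (hval.trans hpow.symm) with h1 | h1
  · exact hv₂ h1
  · exact hv₂' h1

include hπ hε hu in
/-- ★★ **The case `k = 1`: `n₂ = n₁` and `v₂ ≠ ±γ ⟹ ha₂`** — e.g. de Shalit's `𝔞₁ = (α₁)` and the CONJUGATE ideal `𝔞₂ = (ᾱ₁)`
(`N𝔞₂ = N𝔞₁`, `χ_π(σ̃_{𝔞₂}) = ᾱ₁ ≠ ±α₁ = ±γ` as soon as `α₁ ∉ ℚ ∪ ℚ√d_K`). [cite: deShalit1987, Ch. II §4.12 (29)–(33)] -/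
theorem maxEval_twistFactor_ne_zero_of_ne_of_ne_neg_self [CharZero F] {n₁ : ℕ} (g₁ g₂ : (PowerSeries 𝒪[F])ˣ)
    (hg₁ : PowerSeries.constantCoeff (g₁ : PowerSeries 𝒪[F]) = 1) (hg₂ : PowerSeries.constantCoeff (g₂ : PowerSeries 𝒪[F]) = 1)
    (hb : ((n₁ : ℕ) : PowerSeries 𝒪[F]) * ((g₁⁻¹ : (PowerSeries 𝒪[F])ˣ) : PowerSeries 𝒪[F]) - 1 ∈ maximalIdeal (PowerSeries 𝒪[F]))
    (hn₁ : π ^ 2 ∣ (n₁ : 𝒪[F]) - 1) (hn₁' : n₁ ≠ 1) {v₂ : 𝒪[F]ˣ} (hv₂ : v₂ ≠ γ) (hv₂' : v₂ ≠ -γ) :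
    maxEval hb (colemanDeltaCoinvFun hπ hq (intBase F) u hu γ (eq_zero_of_C_pi_mul_eq_zero_integer hπ) w hγ ε
        (unitTwistₗ hπ hq (intBase F) u hu γ v₂ (TActModule.ofPS _ _ 1)) -
      PowerSeries.C (((n₁ : ℕ) : PowerSeries 𝒪[F]) * ((g₂⁻¹ : (PowerSeries 𝒪[F])ˣ) : PowerSeries 𝒪[F]))) ≠ 0 :=
  maxEval_twistFactor_ne_zero_of_ne_of_ne_neg hπ hq u hu γ w hγ ε hε g₁ g₂ hg₁ hg₂ hb hn₁ hn₁' (pow_one n₁).symm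
    (by rwa [pow_one]) (by rwa [pow_one])

include hπ hε hu in
/-- ★★★ **THE AUXILIARY INDEX FROM A POWER CHARACTER** (e.g. a RATIONAL index `𝔞₂ = (r)`, `r ∈ ℕ`, `r ≡ 1 mod 𝔤v̄^{ν+1}`:
`χ_π(σ̃_{(r)}) = r`, `N(r) = r²`): with `b = n₁ g₁⁻¹ − 1` (`g_i(0) = 1`), `π² ∣ n₁ − 1`: if `n₂ = v₂^m` in `𝒪_F` while `n₁ ≠ γ^m`,
`v₂ ≠ 1`, `v₂ ≠ −1`, then **`maxEval_b (t_{v₂} − C(n₂ g₂⁻¹)) ≠ 0`**.  For `𝔞₁ = (α₁)`, `m = 2`: `n₁ = α₁ᾱ₁ ≠ α₁² = γ²` iff `ᾱ₁ ≠ α₁`.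
[cite: deShalit1987, Ch. II §4.12 (29)–(33)] [cite: Serre1973CourseArithmetic, Ch. II §3.2 Thm. 3] -/
theorem maxEval_twistFactor_ne_zero_of_natCast_eq_pow {n₁ n₂ m : ℕ} (g₁ g₂ : (PowerSeries 𝒪[F])ˣ)
    (hg₁ : PowerSeries.constantCoeff (g₁ : PowerSeries 𝒪[F]) = 1) (hg₂ : PowerSeries.constantCoeff (g₂ : PowerSeries 𝒪[F]) = 1)
    (hb : ((n₁ : ℕ) : PowerSeries 𝒪[F]) * ((g₁⁻¹ : (PowerSeries 𝒪[F])ˣ) : PowerSeries 𝒪[F]) - 1 ∈ maximalIdeal (PowerSeries 𝒪[F]))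
    (hn₁ : π ^ 2 ∣ (n₁ : 𝒪[F]) - 1) (hne : (n₁ : 𝒪[F]) ≠ (γ : 𝒪[F]) ^ m)
    {v₂ : 𝒪[F]ˣ} (hn₂ : (n₂ : 𝒪[F]) = (v₂ : 𝒪[F]) ^ m) (hv₂ : v₂ ≠ 1) (hv₂' : v₂ ≠ -1) :
    maxEval hb (colemanDeltaCoinvFun hπ hq (intBase F) u hu γ (eq_zero_of_C_pi_mul_eq_zero_integer hπ) w hγ ε
        (unitTwistₗ hπ hq (intBase F) u hu γ v₂ (TActModule.ofPS _ _ 1)) -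
      PowerSeries.C (((n₂ : ℕ) : PowerSeries 𝒪[F]) * ((g₂⁻¹ : (PowerSeries 𝒪[F])ˣ) : PowerSeries 𝒪[F]))) ≠ 0 := by
  intro h
  set Ψ : PowerSeries (PowerSeries 𝒪[F]) →+* 𝒪[F] := (PowerSeries.constantCoeff (R := 𝒪[F])).comp (maxEvalHom hb) with hΨ
  have hΨX : Ψ PowerSeries.X = (n₁ : 𝒪[F]) - 1 := by
    rw [hΨ, RingHom.comp_apply, maxEvalHom_apply, maxEval_X, constantCoeff_natCast_mul_inv_sub_one n₁ g₁ hg₁]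
  have hΨ2 : π ^ 2 ∣ Ψ PowerSeries.X := by rw [hΨX]; exact hn₁
  have hne' : 1 + Ψ PowerSeries.X ≠ (γ : 𝒪[F]) ^ m := by rw [hΨX, add_sub_cancel]; exact hne
  have hval : Ψ (colemanDeltaCoinvFun hπ hq (intBase F) u hu γ (eq_zero_of_C_pi_mul_eq_zero_integer hπ) w hγ ε
      (unitTwistₗ hπ hq (intBase F) u hu γ v₂ (TActModule.ofPS _ _ 1))) = (v₂ : 𝒪[F]) ^ m := by
    have h0 : Ψ (colemanDeltaCoinvFun hπ hq (intBase F) u hu γ (eq_zero_of_C_pi_mul_eq_zero_integer hπ) w hγ ε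
        (unitTwistₗ hπ hq (intBase F) u hu γ v₂ (TActModule.ofPS _ _ 1)) -
        PowerSeries.C (((n₂ : ℕ) : PowerSeries 𝒪[F]) * ((g₂⁻¹ : (PowerSeries 𝒪[F])ˣ) : PowerSeries 𝒪[F]))) = 0 := by
      rw [hΨ, RingHom.comp_apply, maxEvalHom_apply, h, map_zero]
    rw [map_sub, sub_eq_zero] at h0
    rw [h0, hΨ, RingHom.comp_apply, maxEvalHom_apply, maxEval_C, map_mul, map_natCast, constantCoeff_units_inv_eq_one g₂ hg₂, mul_one,
      hn₂]
  rcases units_eq_one_or_eq_neg_one_of_eval_twistScalar_eq_pow hπ hq (intBase F) u hu γ (eq_zero_of_C_pi_mul_eq_zero_integer hπ) w hγ ε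
    hε Ψ hΨ2 m hne' hval with h1 | h1
  · exact hv₂ h1
  · exact hv₂' h1

end Integer

/-! ### §3. S43's `∃! L_ε` on the `ℤ/d`-trace with the auxiliary index from `n_{a₂} = n_{a₁}^k`, `χ_π(σ̃_{a₂}) ≠ ±γ^k` -/

section Trace

variable {p : ℕ} [hp : Fact p.Prime] {d : ℕ} (hd : d.Coprime p)
variable {π : 𝒪[F]} (hπ : (valuation F).IsUniformizer (π : F))
variable (E : ℕ → IntermediateField F (AlgebraicClosure F)) [∀ m, FiniteDimensional F (E m)] [∀ m, Normal F (E m)]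
  [∀ m, IsGalois F (E m)] (hmono : Monotone E) (hE : ∀ m, E m ≤ maxUnramified F) (hdeg : ∀ m, Module.finrank F (E m) = d * p ^ m)
  {σ₀ : absoluteGaloisGroup F} (hσ₀ : IsAbsArithFrob σ₀) (hq : residueFieldCard F = 2)
variable (u : (LTCoeff F)ˣ) (hu : LTCoeff.of F π = residueFieldCard F * u) (γ : 𝒪[F]ˣ)
variable [IsAdicComplete (Ideal.span {intBase F (LTCoeff.of F π)}) (PowerSeries 𝒪[F])]
variable (w : 𝒪[F]ˣ) (hγ : (γ : 𝒪[F]) = 1 + π ^ 2 * w) (ε : PowerSeries (PowerSeries 𝒪[F])) (hε : ε * ε = 1)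
variable [NeZero d] [IsAdicComplete (Ideal.span {(p : 𝒪[F])}) 𝒪[F]]
variable {θ : ∀ m, unitBall (E m)} (hθ : ∀ m, IsIntegralNormalGen (E m) (θ m))
  (hcoh : ∀ m, unitBallTrace (hmono (Nat.le_succ m)) (θ (m + 1)) = θ m)
variable [CharZero F]

include hdeg hε in
/-- ★★ **De Shalit II §4.12 on the `ℤ/d`-trace (every `d`), auxiliary index from `n_{a₂} = n_{a₁}^k` and `χ_π(σ̃_{a₂}) ≠ ±γ^k`**:
as `existsUnique_colemanDeltaCoinvFun_colemanImageCoh_trace_eq_twistMul` (S43) with `ha₂` DISCHARGED by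
`maxEval_twistFactor_ne_zero_of_ne_of_ne_neg` (`π² ∣ n_{a₁} − 1`, `n_{a₁} ≠ 1`). [cite: deShalit1987, Ch. II §4.12 (29)–(33), §4.14 Step 1] -/
theorem existsUnique_colemanDeltaCoinvFun_colemanImageCoh_trace_eq_twistMul_of_ne {I : Type*} (β : I → coherentFamilies hπ E hmono)
    (σ : I → absoluteGaloisGroup F) (g : I → (PowerSeries 𝒪[F])ˣ) (s : I → ZMod d)
    (hg : ∀ i m, ∃ a : ℕ, (∀ x : E m, σ i • (x : AlgebraicClosure F) = (σ₀ ^ a) • (x : AlgebraicClosure F)) ∧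
      ((1 + PowerSeries.X : PowerSeries 𝒪[F]) ^ p ^ m - 1) ∣ (g i : PowerSeries 𝒪[F]) - (1 + PowerSeries.X) ^ a ∧ (a : ZMod d) = s i)
    (n : I → ℕ)
    (hrel : ∀ (a c : I) (m : ℕ), ((β a).1 m).galAct (σ c) * (β c).1 m ^ n a = ((β c).1 m).galAct (σ a) * (β a).1 m ^ n c)
    (a₁ a₂ : I) (hv₁ : lubinTateChar hπ (σ a₁) = γ) (hn₁ : π ^ 2 ∣ (n a₁ : 𝒪[F]) - 1) (hn₁' : n a₁ ≠ 1)
    {k : ℕ} (hn₂ : n a₂ = n a₁ ^ k) (hv₂ : lubinTateChar hπ (σ a₂) ≠ γ ^ k) (hv₂' : lubinTateChar hπ (σ a₂) ≠ -γ ^ k) :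
    ∃! L : PowerSeries (PowerSeries 𝒪[F]), ∀ c : I,
      colemanDeltaCoinvFun hπ hq (intBase F) u hu γ (eq_zero_of_C_pi_mul_eq_zero_integer hπ) w hγ ε
          (indexTraceₗ hπ hq u hu γ (colemanImageCoh hd hπ E hmono hE hdeg hσ₀ hq u hu γ hθ hcoh (β c))) =
        (colemanDeltaCoinvFun hπ hq (intBase F) u hu γ (eq_zero_of_C_pi_mul_eq_zero_integer hπ) w hγ ε
            (unitTwistₗ hπ hq (intBase F) u hu γ (lubinTateChar hπ (σ c)) (TActModule.ofPS _ _ 1)) *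
            PowerSeries.C (g c : PowerSeries 𝒪[F]) - PowerSeries.C ((n c : ℕ) : PowerSeries 𝒪[F])) * L :=
  existsUnique_colemanDeltaCoinvFun_colemanImageCoh_trace_eq_twistMul hd hπ E hmono hE hdeg hσ₀ hq u hu γ w hγ ε hε hθ hcoh β σ g s hg n
    hrel a₁ a₂ hv₁ ((dvd_pow_self π two_ne_zero).trans hn₁)
    (maxEval_twistFactor_ne_zero_of_ne_of_ne_neg hπ hq u hu γ w hγ ε hε (g a₁) (g a₂) (constantCoeff_eq_one_of_amice E (p := p) (hg a₁))
      (constantCoeff_eq_one_of_amice E (p := p) (hg a₂)) _ hn₁ hn₁' hn₂ hv₂ hv₂')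

omit [CharZero F] in
include hdeg hε in
/-- ★★ **De Shalit II §4.12 on the `ℤ/d`-trace (every `d`), auxiliary index from a POWER CHARACTER** (e.g. a rational index `𝔞₂ = (r)`):
as `existsUnique_colemanDeltaCoinvFun_colemanImageCoh_trace_eq_twistMul` (S43) with `ha₂` DISCHARGED by
`maxEval_twistFactor_ne_zero_of_natCast_eq_pow` (`π² ∣ n_{a₁} − 1`, `n_{a₁} ≠ γ^m`, `n_{a₂} = χ_π(σ̃_{a₂})^m`, `χ_π(σ̃_{a₂}) ≠ ±1`).
[cite: deShalit1987, Ch. II §4.12 (29)–(33), §4.14 Step 1] -/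
theorem existsUnique_colemanDeltaCoinvFun_colemanImageCoh_trace_eq_twistMul_of_natCast_eq_pow {I : Type*} (β : I → coherentFamilies hπ E hmono)
    (σ : I → absoluteGaloisGroup F) (g : I → (PowerSeries 𝒪[F])ˣ) (s : I → ZMod d)
    (hg : ∀ i m, ∃ a : ℕ, (∀ x : E m, σ i • (x : AlgebraicClosure F) = (σ₀ ^ a) • (x : AlgebraicClosure F)) ∧
      ((1 + PowerSeries.X : PowerSeries 𝒪[F]) ^ p ^ m - 1) ∣ (g i : PowerSeries 𝒪[F]) - (1 + PowerSeries.X) ^ a ∧ (a : ZMod d) = s i)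
    (n : I → ℕ)
    (hrel : ∀ (a c : I) (m : ℕ), ((β a).1 m).galAct (σ c) * (β c).1 m ^ n a = ((β c).1 m).galAct (σ a) * (β a).1 m ^ n c)
    (a₁ a₂ : I) (hv₁ : lubinTateChar hπ (σ a₁) = γ) (hn₁ : π ^ 2 ∣ (n a₁ : 𝒪[F]) - 1)
    {m : ℕ} (hne : (n a₁ : 𝒪[F]) ≠ (γ : 𝒪[F]) ^ m) (hn₂ : (n a₂ : 𝒪[F]) = (lubinTateChar hπ (σ a₂) : 𝒪[F]) ^ m)
    (hv₂ : lubinTateChar hπ (σ a₂) ≠ 1) (hv₂' : lubinTateChar hπ (σ a₂) ≠ -1) :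
    ∃! L : PowerSeries (PowerSeries 𝒪[F]), ∀ c : I,
      colemanDeltaCoinvFun hπ hq (intBase F) u hu γ (eq_zero_of_C_pi_mul_eq_zero_integer hπ) w hγ ε
          (indexTraceₗ hπ hq u hu γ (colemanImageCoh hd hπ E hmono hE hdeg hσ₀ hq u hu γ hθ hcoh (β c))) =
        (colemanDeltaCoinvFun hπ hq (intBase F) u hu γ (eq_zero_of_C_pi_mul_eq_zero_integer hπ) w hγ ε
            (unitTwistₗ hπ hq (intBase F) u hu γ (lubinTateChar hπ (σ c)) (TActModule.ofPS _ _ 1)) *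
            PowerSeries.C (g c : PowerSeries 𝒪[F]) - PowerSeries.C ((n c : ℕ) : PowerSeries 𝒪[F])) * L :=
  existsUnique_colemanDeltaCoinvFun_colemanImageCoh_trace_eq_twistMul hd hπ E hmono hE hdeg hσ₀ hq u hu γ w hγ ε hε hθ hcoh β σ g s hg n
    hrel a₁ a₂ hv₁ ((dvd_pow_self π two_ne_zero).trans hn₁)
    (maxEval_twistFactor_ne_zero_of_natCast_eq_pow hπ hq u hu γ w hγ ε hε (g a₁) (g a₂) (constantCoeff_eq_one_of_amice E (p := p) (hg a₁))
      (constantCoeff_eq_one_of_amice E (p := p) (hg a₂)) _ hn₁ hne hn₂ hv₂ hv₂')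

end Trace

end Literature.NumberTheory.EllipticCurves
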